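import Literature.AlgebraicGeometry.Motives.HodgeLieUnitaryTimesCMSummandSU
import Literature.AlgebraicGeometry.Motives.HodgeLieUnitarySUDerived
import Literature.AlgebraicGeometry.HodgeTheory.CMEllipticCurveSquaredHodgeLieCommutant
import HarnessLib

/-!
# `Lie Hg(H¹(Y₄ × E_K²)) ⊗ ℂ ⊇ 𝔰(𝔲(W_Y) ⊕ 𝔲_K(1))_ℂ` — the AV READING of the Weil PRODUCT brick for TABLE X ROW 20
# (`E_K² × Y₄^{(3,1)}`: `Y` a fourfold with `End⁰ = K` imaginary quadratic of signature `(3,1)`, `E` an elliptic curve with CM by the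
# SAME `K`, the diagonal `K` on `Y × E × E` of Weil type `(3,3)`) (Moonen–Zarhin 1995 §2, 1999 (5.11); Ribet 1983 Thm. 3)

Family `hodge`, layer `Literature/AlgebraicGeometry/HodgeTheory` (cell `pub-hodgeav-hg6`, req-37 (A) Q2b, TABLE X ROW 20; eng-5 g7, brick R20-AV;
lead g4 2026-08-29 l.670). UNCONDITIONAL in its displayed shape; theorems only, no definition, no named fact, no instance, no `sorry`. HONEST
FRAMING of that cell: HC ∕ HC_AV (stmt-1333) ∕ HC_CM (stmt-3052) ∕ H2 NOT proved — a statement about `Lie Hg(Y × E × E)`.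

WHAT THIS FILE DOES. The Hodge-structure brick `WeilProductCM.mem_hodgeLieC_of_commute_of_skew_of_trace_of_abelian`
(`Motives/HodgeLieUnitaryTimesCMSummandSU`, eng-3 g4 v1.2: `H ≅ H₁ ⊕ H₂` with `𝔥(H₂)` ABELIAN and the `V₂`-corner of the operator in
`𝔥(H₂)_ℂ`) is READ on `Y × (E × E)` through the bicone `H¹(Y × E²) = fst^* H¹(Y) ⊕ snd^* H¹(E²)` (dictionary of
`Motives/HodgeLieOfAbelianVarietySemisimpleTimesCM`, as in eng-4 g9's row-17 reading `WeilTypeFivefoldTimesCMCurveHodgeLieSU`), with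
* `hLie₁` DISCHARGED for `Y = Y₄` (`dim Y = 4`, `finrank_ℚ End⁰(Y) = 2`, `φ_Y ≫ φ_Y = −d`, multiplicity `3` or `1` at `i√d`) by the tree's
  `(m,1)` core `UnitaryTheta.mem_spanC_of_commute_of_skew` (`Motives/HodgeThetaSubalgebraUnitary`; Ribet's Thm. 3) through F17's dictionary
  (`exists_eq_smul_one_add_smul_bettiMapHom`, `finrank_eigenspace_inf_piece_oneZero∕zeroOne_eq_eigenMultiplicity`, `bettiMapHom_mul_self`);
* `hSL₁` DISCHARGED by K1b `UnitarySU.mem_span_commutator_of_trace` (`Motives/HodgeLieUnitarySUDerived`);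
* `hab₂`, `hY₂` DISCHARGED by F20 `CMCurveSq.hodgeLie_mul_comm` ∕ `CMCurveSq.mem_hodgeLieC_of_commute_of_skew`
  (`HodgeTheory/CMEllipticCurveSquaredHodgeLieCommutant`) for the restricted polarization `ψ ∘ (snd^* × snd^*)`
  (`WeilProductCM.exists_polarization_comp`), the `V₂`-corner of the operator commuting with `End(E × E)^*_ℂ` because the operator commutes
  with `(snd ≫ g ≫ prodLift 0 𝟙)^* = snd^* g^* (prodLift 0 𝟙)^*`;
* the balance `hbal`, `hbal'` from `IsWeilType (Y × E²) Φ 3 d` for the diagonal `Φ`.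

* **`hodgeLieC_fourfold_prod_cmCurveSq_of_threeOne`** — for EVERY polarization `ψ` of `H¹(Y × E²; ℚ)`: every operator on `H¹(Y × E²; ℂ)`
  commuting with all `θ^*_ℂ`, `θ ∈ End(Y × E²)` (binder `hall`, the lead's antecedent shape (3) of 2026-08-29T08:45Z: the `W_K`-stability
  proof of the trace term is `UnitaryTheta.apply_mem_eigenspace_of_commute (hall Φ)`), skew for `ψ_ℂ` and traceless on
  `W_K = ker(Φ^*_ℂ − i√d)` lies in `Lie Hg(H¹(Y × E²)) ⊗ ℂ` («special members = ∅» for row 20 at the Lie level; all four brick inputs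
  discharged, nothing displayed).
Not here: the Lie→group passage (eng-2's socket), the census re-key of L18 `census_weilType_detOne_general_prod_prod`, anything about HC.

## References
* [MoonenZarhin1999LowDim] B. Moonen, Yu. Zarhin, Math. Ann. 315 (1999), §2 (2.3), §3 (3.6)–(3.8), §5 (5.11).
* [Ribet1983] K. A. Ribet, Amer. J. Math. 105 (1983), Thm. 3.
* [Deligne1982HodgeCycles] P. Deligne, LNM 900 (1982), I §3 Prop. 3.4 and 3.6; §4.
* [VoisinHodgeI2002] C. Voisin, Hodge Theory I (2002), §7.3.2 and Lemma 7.26.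
-/

noncomputable section

open scoped TensorProduct
open CategoryTheory CategoryTheory.Limits Module

namespace Literature.AlgebraicGeometry.HodgeTheory

open Literature.AlgebraicTopology.SingularHomology
open Literature.AlgebraicGeometry.Motives
open Literature.AlgebraicGeometry.Motives.AbelianVariety
open Literature.AlgebraicGeometry.Motives.HodgeStructure
open Literature.AlgebraicGeometry.ComplexMultiplication (bettiRep bettiRep_of bettiCohomology_map_comp_hom)

variable {Y E : AbelianVariety ℂ}

/-- `(f ≫ g)^* = f^* ∘ g^*` on `H¹(−; ℚ)`, for the linear maps. [folklore] -/
private theorem R20.pull_comp_eq {A B C : AbelianVariety ℂ} (f : A ⟶ B) (g : B ⟶ C) :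
    BettiUniverse.pull (f ≫ g).hom.hom.hom 1 = BettiUniverse.pull f.hom.hom.hom 1 ∘ₗ BettiUniverse.pull g.hom.hom.hom 1 := by
  change (bettiCohomology.map (f ≫ g).hom.hom.hom 1).hom = _
  rw [bettiCohomology_map_comp_hom, ModuleCat.hom_comp]

/-- **ROW 20 AT THE LIE LEVEL — `Lie Hg(H¹(Y₄ × E_K²)) ⊗ ℂ ⊇ 𝔰(𝔲(W_Y) ⊕ 𝔲_K(1))_ℂ`** (see the module docstring): `Y` with `dim Y = 4`,
`finrank_ℚ End⁰(Y) = 2`, `φ_Y ≫ φ_Y = −d`, multiplicity `3` or `1` at `i√d`; `E` an elliptic curve with `χ ≫ χ = −d` (same `d`), `Φ₂` the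
diagonal endomorphism of `E × E` and `Φ` that of `Y × (E × E)`, of Weil type `(3, d)`. Then for every polarization `ψ` of `H¹(Y × E²; ℚ)`:
every operator commuting with every `f^*_ℂ`, `f ∈ End(Y × E²)`, `ψ_ℂ`-skew and traceless on `W_K = ker(Φ^*_ℂ − i√d)`, lies in
`Lie Hg(H¹(Y × E²)) ⊗ ℂ`. [cite: MoonenZarhin1999LowDim, §2 (2.3), §3 (3.6)–(3.8) and §5 (5.11)] [cite: Ribet1983, Thm. 3]
[cite: Deligne1982HodgeCycles, I §3 Prop. 3.4 and 3.6] -/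
theorem hodgeLieC_fourfold_prod_cmCurveSq_of_threeOne [HodgeTensorFacts.{0, 0}]
    (hY4 : Y.dim = 4) (φY : Y ⟶ Y) {d : ℕ} (hd : 0 < d) (hφY : φY ≫ φY = -(d • 𝟙 Y))
    (hE2 : Module.finrank ℚ Y.endAlgebra = 2)
    (h31 : eigenMultiplicity Y φY (Complex.I * (Real.sqrt d : ℂ)) = 3 ∨ eigenMultiplicity Y φY (Complex.I * (Real.sqrt d : ℂ)) = 1)
    (hE1 : E.dim = 1) (χ : E ⟶ E) (hχ : χ ≫ χ = -(d • 𝟙 E))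
    (Φ₂ : E.prod E ⟶ E.prod E) (hΦ₂a : Φ₂ ≫ fst E E = fst E E ≫ χ) (hΦ₂b : Φ₂ ≫ snd E E = snd E E ≫ χ)
    (Φ : Y.prod (E.prod E) ⟶ Y.prod (E.prod E)) (hΦ₁ : Φ ≫ fst Y (E.prod E) = fst Y (E.prod E) ≫ φY)
    (hΦ₂ : Φ ≫ snd Y (E.prod E) = snd Y (E.prod E) ≫ Φ₂)
    (hW : IsWeilType (Y.prod (E.prod E)) Φ 3 d)
    (ψ : (BettiUniverse.hodge exists_isReal_hodgeModel_holds (AbelianVariety.isSmoothProjective_holds (A := Y.prod (E.prod E))) 1).Polarization) :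
    ∀ (Yop : Module.End ℂ (ℂ ⊗[ℚ] bettiCohomology (Y.prod (E.prod E)).X 1))
      (hall : ∀ θ : Y.prod (E.prod E) ⟶ Y.prod (E.prod E),
        Yop * ((bettiCohomology.map θ.hom.hom.hom 1).hom).baseChange ℂ = ((bettiCohomology.map θ.hom.hom.hom 1).hom).baseChange ℂ * Yop),
      (∀ x y, ψ.form.baseChange ℂ (Yop x) y + ψ.form.baseChange ℂ x (Yop y) = 0) →
      LinearMap.trace ℂ _ (Yop.restrict fun x (hx : x ∈ Module.End.eigenspace
          (((bettiCohomology.map Φ.hom.hom.hom 1).hom).baseChange ℂ) (Complex.I * (Real.sqrt d : ℂ))) =>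
        UnitaryTheta.apply_mem_eigenspace_of_commute (hall Φ) hx) = 0 →
      Yop ∈ (BettiUniverse.hodge exists_isReal_hodgeModel_holds (AbelianVariety.isSmoothProjective_holds (A := Y.prod (E.prod E))) 1).hodgeLieC := by
  classical
  intro Yop hall hYskew hYtr
  have hYE := hall
  have hHD : exists_isReal_hodgeModel := exists_isReal_hodgeModel_holds
  have hI : hodgePQ_independent_of_hodgeModel := hodgePQ_independent_of_hodgeModel_holds
  have hP : IsSmoothProjective (Y.prod (E.prod E)).dim (Y.prod (E.prod E)).X := AbelianVariety.isSmoothProjective_holds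
  have hXY : IsSmoothProjective Y.dim Y.X := AbelianVariety.isSmoothProjective_holds
  have hXE2 : IsSmoothProjective (E.prod E).dim (E.prod E).X := AbelianVariety.isSmoothProjective_holds
  haveI : Module.Finite ℚ (bettiCohomology (Y.prod (E.prod E)).X 1) := finite_bettiCohomology_one _
  haveI : Module.Finite ℚ (bettiCohomology Y.X 1) := finite_bettiCohomology_one _
  haveI : Module.Finite ℚ (bettiCohomology (E.prod E).X 1) := finite_bettiCohomology_one _
  -- the bicone of `H¹(Y × E²)`
  let ι₁ := BettiUniverse.pullHodgeHom hHD hI hP hXY (fst Y (E.prod E)).hom.hom.hom 1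
  let π₁ := BettiUniverse.pullHodgeHom hHD hI hXY hP (prodLift (𝟙 Y) (0 : Y ⟶ E.prod E)).hom.hom.hom 1
  let ι₂ := BettiUniverse.pullHodgeHom hHD hI hP hXE2 (snd Y (E.prod E)).hom.hom.hom 1
  let π₂ := BettiUniverse.pullHodgeHom hHD hI hXE2 hP (prodLift (0 : E.prod E ⟶ Y) (𝟙 (E.prod E))).hom.hom.hom 1
  have hsumP : fst Y (E.prod E) ≫ prodLift (𝟙 Y) (0 : Y ⟶ E.prod E) +
      snd Y (E.prod E) ≫ prodLift (0 : E.prod E ⟶ Y) (𝟙 (E.prod E)) = 𝟙 _ := by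
    refine prod_hom_ext ?_ ?_
    · rw [Preadditive.add_comp, Category.assoc, Category.assoc, prodLift_fst, prodLift_fst, Category.comp_id,
        comp_zero, add_zero, Category.id_comp]
    · rw [Preadditive.add_comp, Category.assoc, Category.assoc, prodLift_snd, prodLift_snd, Category.comp_id,
        comp_zero, zero_add, Category.id_comp]
  have hπι₁ : ∀ v, π₁.toLinearMap (ι₁.toLinearMap v) = v := fun v => pull_pull_eq_self_of_comp_eq_id (prodLift_fst _ _) v
  have hπι₂ : ∀ v, π₂.toLinearMap (ι₂.toLinearMap v) = v := fun v => pull_pull_eq_self_of_comp_eq_id (prodLift_snd _ _) v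
  have hsum : ∀ v, ι₁.toLinearMap (π₁.toLinearMap v) + ι₂.toLinearMap (π₂.toLinearMap v) = v := fun v =>
    pull_pull_add_pull_pull_eq_self _ _ _ _ hsumP v
  have hπι₁' : π₁.toLinearMap ∘ₗ ι₁.toLinearMap = LinearMap.id := LinearMap.ext hπι₁
  have hπι₂' : π₂.toLinearMap ∘ₗ ι₂.toLinearMap = LinearMap.id := LinearMap.ext hπι₂
  have hsum' : ι₁.toLinearMap ∘ₗ π₁.toLinearMap + ι₂.toLinearMap ∘ₗ π₂.toLinearMap = LinearMap.id := LinearMap.ext hsum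
  -- effectivity, the Hodge operator of `H¹(Y)`
  have heff := BettiUniverse.hodge_isEffective hHD hP 1
  have heff₁ := BettiUniverse.hodge_isEffective hHD hXY 1
  obtain ⟨Θ₁, hΘ₁⟩ := exists_hodgeTheta (BettiUniverse.hodge hHD hXY 1)
  -- the endomorphisms `φ_Y^*`, `Φ₂^*`, `Φ^*`
  set φ₁ : Module.End ℚ (bettiCohomology Y.X 1) := (bettiCohomology.map φY.hom.hom.hom 1).hom with hφ₁def
  set φ₂ : Module.End ℚ (bettiCohomology (E.prod E).X 1) := (bettiCohomology.map Φ₂.hom.hom.hom 1).hom with hφ₂def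
  set ΦQ : Module.End ℚ (bettiCohomology (Y.prod (E.prod E)).X 1) := (bettiCohomology.map Φ.hom.hom.hom 1).hom with hΦQdef
  have hφ₁E : φ₁ ∈ (BettiUniverse.hodge hHD hXY 1).endAlg := by
    have h := unop_bettiRep_mem_endAlg hHD hI (AbelianVariety.endAlgebra.of Y φY)
    rwa [bettiRep_of, MulOpposite.unop_op] at h
  have hΦE : ΦQ ∈ (BettiUniverse.hodge hHD hP 1).endAlg := by
    have h := unop_bettiRep_mem_endAlg hHD hI (AbelianVariety.endAlgebra.of (Y.prod (E.prod E)) Φ)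
    rwa [bettiRep_of, MulOpposite.unop_op] at h
  have hdQ : (0 : ℚ) < d := Nat.cast_pos.2 hd
  have hφ₁sq : φ₁ * φ₁ = -((d : ℚ) • 1) := bettiMapHom_mul_self hφY
  have hΦ₂sq' : Φ₂ ≫ Φ₂ = -(d • 𝟙 (E.prod E)) := by
    refine prod_hom_ext ?_ ?_
    · rw [Category.assoc, hΦ₂a, ← Category.assoc, hΦ₂a, Category.assoc, hχ]
      simp only [Preadditive.comp_neg, Preadditive.neg_comp, Preadditive.comp_nsmul, Preadditive.nsmul_comp,
        Category.comp_id, Category.id_comp]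
    · rw [Category.assoc, hΦ₂b, ← Category.assoc, hΦ₂b, Category.assoc, hχ]
      simp only [Preadditive.comp_neg, Preadditive.neg_comp, Preadditive.comp_nsmul, Preadditive.nsmul_comp,
        Category.comp_id, Category.id_comp]
  have hφ₂sq : φ₂ * φ₂ = -((d : ℚ) • 1) := bettiMapHom_mul_self hΦ₂sq'
  have hμ : (Complex.I * (Real.sqrt d : ℂ)) ^ 2 = -((d : ℚ) : ℂ) := by
    rw [mul_pow, Complex.I_sq, ← Complex.ofReal_pow, Real.sq_sqrt (Nat.cast_nonneg d), Complex.ofReal_natCast,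
      Rat.cast_natCast, neg_one_mul]
  have hμ' : (-(Complex.I * (Real.sqrt d : ℂ))) ^ 2 = -((d : ℚ) : ℂ) := by rw [neg_sq, hμ]
  have hconj : starRingEnd ℂ (Complex.I * (Real.sqrt d : ℂ)) = -(Complex.I * (Real.sqrt d : ℂ)) := by simp
  -- the gluing of the `K`-action
  have hΦ₁' : ΦQ ∘ₗ ι₁.toLinearMap = ι₁.toLinearMap ∘ₗ φ₁ := by
    change BettiUniverse.pull Φ.hom.hom.hom 1 ∘ₗ BettiUniverse.pull (fst Y (E.prod E)).hom.hom.hom 1 =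
      BettiUniverse.pull (fst Y (E.prod E)).hom.hom.hom 1 ∘ₗ BettiUniverse.pull φY.hom.hom.hom 1
    rw [← R20.pull_comp_eq, ← R20.pull_comp_eq, hΦ₁]
  have hΦ₂' : ΦQ ∘ₗ ι₂.toLinearMap = ι₂.toLinearMap ∘ₗ φ₂ := by
    change BettiUniverse.pull Φ.hom.hom.hom 1 ∘ₗ BettiUniverse.pull (snd Y (E.prod E)).hom.hom.hom 1 =
      BettiUniverse.pull (snd Y (E.prod E)).hom.hom.hom 1 ∘ₗ BettiUniverse.pull Φ₂.hom.hom.hom 1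
    rw [← R20.pull_comp_eq, ← R20.pull_comp_eq, hΦ₂]
  -- the balance at `± i√d` from the Weil type `(3,3)` of the diagonal `K`
  have h10 : ∀ cc, Module.finrank ℂ ↥(Module.End.eigenspace (ΦQ.baseChange ℂ) cc ⊓ (BettiUniverse.hodge hHD hP 1).piece 1 0) =
      eigenMultiplicity (Y.prod (E.prod E)) Φ cc := fun cc => by
    rw [hΦQdef, finrank_eigenspace_inf_piece_oneZero_eq_eigenMultiplicity hHD hI Φ]
  have h01 : ∀ cc, Module.finrank ℂ ↥(Module.End.eigenspace (ΦQ.baseChange ℂ) cc ⊓ (BettiUniverse.hodge hHD hP 1).piece 0 1) =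
      eigenMultiplicity (Y.prod (E.prod E)) Φ (starRingEnd ℂ cc) := fun cc => by
    rw [hΦQdef, finrank_eigenspace_inf_piece_zeroOne_eq_eigenMultiplicity_conj hHD hI Φ]
  have hbal : Module.finrank ℂ ↥(Module.End.eigenspace (ΦQ.baseChange ℂ) (Complex.I * (Real.sqrt d : ℂ)) ⊓
      (BettiUniverse.hodge hHD hP 1).piece 1 0) =
      Module.finrank ℂ ↥(Module.End.eigenspace (ΦQ.baseChange ℂ) (Complex.I * (Real.sqrt d : ℂ)) ⊓
      (BettiUniverse.hodge hHD hP 1).piece 0 1) := by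
    rw [h10, h01, hconj, hW.eigenMultiplicity_eq, hW.eigenMultiplicity_neg_eq]
  have hbal' : Module.finrank ℂ ↥(Module.End.eigenspace (ΦQ.baseChange ℂ) (-(Complex.I * (Real.sqrt d : ℂ))) ⊓
      (BettiUniverse.hodge hHD hP 1).piece 1 0) =
      Module.finrank ℂ ↥(Module.End.eigenspace (ΦQ.baseChange ℂ) (-(Complex.I * (Real.sqrt d : ℂ))) ⊓
      (BettiUniverse.hodge hHD hP 1).piece 0 1) := by
    rw [h10, h01, map_neg, hconj, neg_neg, hW.eigenMultiplicity_eq, hW.eigenMultiplicity_neg_eq]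
  -- `hLie₁` for `Y₄`: the `(m,1)` core through F17's dictionary, at the eigenvalue of multiplicity `1` on `H^{0,1}`
  have hsumY := eigenMultiplicity_add_eigenMultiplicity_neg_eq_dim Y φY hd hφY
  have hY0 : 0 < Y.dim := by omega
  have hEY := exists_eq_smul_one_add_smul_bettiMapHom hHD hI hd hφY hE2 hY0
  have h10Y : ∀ cc, Module.finrank ℂ ↥(Module.End.eigenspace (φ₁.baseChange ℂ) cc ⊓ (BettiUniverse.hodge hHD hXY 1).piece 1 0) =
      eigenMultiplicity Y φY cc := fun cc => by
    rw [hφ₁def, finrank_eigenspace_inf_piece_oneZero_eq_eigenMultiplicity hHD hI φY]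
  have h01Y : ∀ cc, Module.finrank ℂ ↥(Module.End.eigenspace (φ₁.baseChange ℂ) cc ⊓ (BettiUniverse.hodge hHD hXY 1).piece 0 1) =
      eigenMultiplicity Y φY (starRingEnd ℂ cc) := fun cc => by
    rw [hφ₁def, finrank_eigenspace_inf_piece_zeroOne_eq_eigenMultiplicity_conj hHD hI φY]
  have hLie₁ : ∀ (ψ₁ : (BettiUniverse.hodge hHD hXY 1).Polarization) (𝔤₁ : Submodule ℚ (Module.End ℚ (bettiCohomology Y.X 1))),
      (∀ X ∈ 𝔤₁, ∀ X' ∈ 𝔤₁, X * X' - X' * X ∈ 𝔤₁) → Θ₁ ∈ spanC 𝔤₁ →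
      (∀ X ∈ 𝔤₁, ∀ a : (BettiUniverse.hodge hHD hXY 1).endAlg,
        X * (a : Module.End ℚ (bettiCohomology Y.X 1)) = (a : Module.End ℚ (bettiCohomology Y.X 1)) * X) →
      (∀ X ∈ 𝔤₁, ∀ v w, ψ₁.form (X v) w + ψ₁.form v (X w) = 0) →
      ∀ T : Module.End ℂ (ℂ ⊗[ℚ] bettiCohomology Y.X 1), T * φ₁.baseChange ℂ = φ₁.baseChange ℂ * T →
        (∀ x y, ψ₁.form.baseChange ℂ (T x) y + ψ₁.form.baseChange ℂ x (T y) = 0) → T ∈ spanC 𝔤₁ := by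
    intro ψ₁ 𝔤₁ hbr hΘ𝔤 hcomm hskew T hTφ hTskew
    rcases h31 with h3 | h1
    · -- multiplicity `3` on `W_{i√d} ∩ H^{1,0}`, `1` on `W_{i√d} ∩ H^{0,1}`
      refine UnitaryTheta.mem_spanC_of_commute_of_skew (BettiUniverse.hodge hHD hXY 1) Nat.cast_one heff₁ ψ₁ hφ₁E hdQ hφ₁sq
        hEY hμ ?_ ?_ 𝔤₁ hbr hΘ₁ hΘ𝔤 hcomm hskew hTφ hTskew
      · rw [h01Y, hconj]; omega
      · rw [h10Y]; omega
    · -- multiplicity `1` on `W_{i√d} ∩ H^{1,0}`: use the eigenvalue `-i√d`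
      refine UnitaryTheta.mem_spanC_of_commute_of_skew (BettiUniverse.hodge hHD hXY 1) Nat.cast_one heff₁ ψ₁ hφ₁E hdQ hφ₁sq
        hEY hμ' ?_ ?_ 𝔤₁ hbr hΘ₁ hΘ𝔤 hcomm hskew hTφ hTskew
      · rw [h01Y, map_neg, hconj, neg_neg]; omega
      · rw [h10Y]; omega
  -- `hSL₁` by K1b
  have hSL₁ : ∀ (ψ₁ : (BettiUniverse.hodge hHD hXY 1).Polarization) (T : Module.End ℂ (ℂ ⊗[ℚ] bettiCohomology Y.X 1)),
      T * φ₁.baseChange ℂ = φ₁.baseChange ℂ * T →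
      (∀ x y, ψ₁.form.baseChange ℂ (T x) y + ψ₁.form.baseChange ℂ x (T y) = 0) →
      LinearMap.trace ℂ _ (φ₁.baseChange ℂ * T) = 0 →
      T ∈ Submodule.span ℂ {D : Module.End ℂ (ℂ ⊗[ℚ] bettiCohomology Y.X 1) | ∃ A B : Module.End ℂ (ℂ ⊗[ℚ] bettiCohomology Y.X 1),
        A * φ₁.baseChange ℂ = φ₁.baseChange ℂ * A ∧ B * φ₁.baseChange ℂ = φ₁.baseChange ℂ * B ∧
        (∀ x y, ψ₁.form.baseChange ℂ (A x) y + ψ₁.form.baseChange ℂ x (A y) = 0) ∧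
        (∀ x y, ψ₁.form.baseChange ℂ (B x) y + ψ₁.form.baseChange ℂ x (B y) = 0) ∧ D = A * B - B * A} :=
    fun ψ₁ T hTφ hTskew htr => UnitarySU.mem_span_commutator_of_trace (BettiUniverse.hodge hHD hXY 1) Nat.cast_one ψ₁ hφ₁E hdQ hφ₁sq
      hEY hTφ hTskew htr
  -- the projector hypothesis in the bicone's form
  have he₁ : (ι₁.toLinearMap ∘ₗ π₁.toLinearMap) =
      (bettiCohomology.map (fst Y (E.prod E) ≫ prodLift (𝟙 Y) (0 : Y ⟶ E.prod E)).hom.hom.hom 1).hom := by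
    change BettiUniverse.pull (fst Y (E.prod E)).hom.hom.hom 1 ∘ₗ BettiUniverse.pull (prodLift (𝟙 Y) (0 : Y ⟶ E.prod E)).hom.hom.hom 1 = _
    rw [← R20.pull_comp_eq]
  have hYe : Yop * (ι₁.toLinearMap ∘ₗ π₁.toLinearMap).baseChange ℂ = (ι₁.toLinearMap ∘ₗ π₁.toLinearMap).baseChange ℂ * Yop := by
    rw [he₁]; exact hYE _
  -- complex notation for the second summand
  set i₁ := ι₁.toLinearMap.baseChange ℂ with hi₁
  set p₁ := π₁.toLinearMap.baseChange ℂ with hp₁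
  set i₂ := ι₂.toLinearMap.baseChange ℂ with hi₂
  set p₂ := π₂.toLinearMap.baseChange ℂ with hp₂
  have hpi₁ : ∀ x, p₁ (i₁ x) = x := proj_incl_baseChange hπι₁'
  have hpi₂ : ∀ x, p₂ (i₂ x) = x := proj_incl_baseChange hπι₂'
  have hsumC : ∀ y, i₁ (p₁ y) + i₂ (p₂ y) = y := incl_proj_add_baseChange hsum'
  have hp₁i₂ : ∀ z, p₁ (i₂ z) = 0 := fun z => by
    have hz := congrArg p₁ (hsumC (i₂ z))
    rw [map_add, hpi₁, hpi₂] at hz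
    exact add_eq_left.1 hz
  -- block-diagonality of `Yop`: `i₂ p₂ Yop i₂ = Yop i₂`
  have hYe' : ∀ x, Yop (i₁ (p₁ x)) = i₁ (p₁ (Yop x)) := fun x => by
    have h := LinearMap.congr_fun hYe x
    rw [LinearMap.baseChange_comp] at h
    simpa only [Module.End.mul_apply, LinearMap.comp_apply] using h
  have hYi₂ : ∀ x, i₂ (p₂ (Yop (i₂ x))) = Yop (i₂ x) := fun x => by
    have h1 : i₁ (p₁ (Yop (i₂ x))) = 0 := by rw [← hYe', hp₁i₂, map_zero, map_zero]
    have h2 := hsumC (Yop (i₂ x))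
    rwa [h1, zero_add] at h2
  -- the `V₂`-corner commutes with `End(E × E)^*_ℂ`
  have hcorner : ∀ g : E.prod E ⟶ E.prod E, (p₂ ∘ₗ Yop ∘ₗ i₂) * ((bettiCohomology.map g.hom.hom.hom 1).hom).baseChange ℂ =
      ((bettiCohomology.map g.hom.hom.hom 1).hom).baseChange ℂ * (p₂ ∘ₗ Yop ∘ₗ i₂) := by
    intro g
    have hf : (bettiCohomology.map (snd Y (E.prod E) ≫ g ≫ prodLift (0 : E.prod E ⟶ Y) (𝟙 (E.prod E))).hom.hom.hom 1).hom =
        ι₂.toLinearMap ∘ₗ (bettiCohomology.map g.hom.hom.hom 1).hom ∘ₗ π₂.toLinearMap := by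
      change BettiUniverse.pull _ 1 = BettiUniverse.pull (snd Y (E.prod E)).hom.hom.hom 1 ∘ₗ BettiUniverse.pull g.hom.hom.hom 1 ∘ₗ
        BettiUniverse.pull (prodLift (0 : E.prod E ⟶ Y) (𝟙 (E.prod E))).hom.hom.hom 1
      rw [R20.pull_comp_eq, R20.pull_comp_eq]
    have h := hYE (snd Y (E.prod E) ≫ g ≫ prodLift (0 : E.prod E ⟶ Y) (𝟙 (E.prod E)))
    rw [hf, LinearMap.baseChange_comp, LinearMap.baseChange_comp] at h
    set gC := ((bettiCohomology.map g.hom.hom.hom 1).hom).baseChange ℂ with hgC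
    have hB : ∀ y, (i₂ ∘ₗ gC ∘ₗ p₂) y = i₂ (gC (p₂ y)) := fun y => rfl
    refine LinearMap.ext fun x => ?_
    change p₂ (Yop (i₂ (gC x))) = gC (p₂ (Yop (i₂ x)))
    have h1 : i₂ (gC x) = (i₂ ∘ₗ gC ∘ₗ p₂) (i₂ x) := by rw [hB, hpi₂]
    rw [h1, ← Module.End.mul_apply Yop, h, Module.End.mul_apply, hB, hpi₂]
  -- the restricted polarization on `H¹(E × E)` and the corner's skewness
  obtain ⟨ψ₂, hψ₂⟩ := WeilProductCM.exists_polarization_comp ι₂ π₂ hπι₂ ψ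
  have hcornerskew : ∀ x y, ψ₂.form.baseChange ℂ ((p₂ ∘ₗ Yop ∘ₗ i₂) x) y + ψ₂.form.baseChange ℂ x ((p₂ ∘ₗ Yop ∘ₗ i₂) y) = 0 := by
    intro x y
    rw [hψ₂, baseChange_compl₁₂, baseChange_compl₁₂]
    change ψ.form.baseChange ℂ (i₂ (p₂ (Yop (i₂ x)))) (i₂ y) + ψ.form.baseChange ℂ (i₂ x) (i₂ (p₂ (Yop (i₂ y)))) = 0
    rw [hYi₂, hYi₂]
    exact hYskew _ _
  -- F20: `𝔥(H¹(E²))` abelian and the corner in `𝔥(H¹(E²))_ℂ`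
  have hab₂ : ∀ X ∈ (BettiUniverse.hodge hHD hXE2 1).hodgeLie, ∀ X' ∈ (BettiUniverse.hodge hHD hXE2 1).hodgeLie, X * X' = X' * X :=
    fun X hX X' hX' => CMCurveSq.hodgeLie_mul_comm hE1 χ hd hχ Φ₂ hΦ₂a hΦ₂b ψ₂ hX hX'
  have hY₂ : p₂ ∘ₗ Yop ∘ₗ i₂ ∈ (BettiUniverse.hodge hHD hXE2 1).hodgeLieC :=
    CMCurveSq.mem_hodgeLieC_of_commute_of_skew hE1 χ hd hχ Φ₂ hΦ₂a hΦ₂b ψ₂ hcorner hcornerskew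
  -- the brick (eng-3 g4's v1.2)
  exact WeilProductCM.mem_hodgeLieC_of_commute_of_skew_of_trace_of_abelian ι₁ π₁ ι₂ π₂ hπι₁ hπι₂ hsum Nat.cast_one heff ψ hφ₁E
    hdQ hφ₁sq hφ₂sq hμ hΦE hΦ₁' hΦ₂' hbal hbal' hΘ₁ hLie₁ hSL₁ hab₂ hYe (hall Φ) hYskew hYtr hY₂

end Literature.AlgebraicGeometry.HodgeTheory

end
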